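import Summits.CriticalPhenomena.Ising3DConformalLimit.Theorems.PrecisionLaplacianDirectCorrelationStableTailPickInversionAux8
import Summits.CriticalPhenomena.Ising3DConformalLimit.Theorems.PrecisionLaplacianDirectCorrelationStableTailPickInversionAux17
import Summits.CriticalPhenomena.Ising3DConformalLimit.Theorems.PrecisionLaplacianEtaBoundsTransferEquation
import Literature.Probability.LatticeModels.CriticalTwoPointLawDimension
import Literature.Probability.LatticeModels.CriticalTwoPointLower
import Literature.Probability.LatticeModels.HighDimPointwiseTriviality

/-!
# Stub `stub_pickInversion` of line `self-energy-pick-inversion` for crux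
# `PrecisionLaplacian.DirectCorrelationStableTail` (stmt-CriticalPhenomena-4799)

**Statement** (package form `IsSymmPotentialKernel G → Summable dcf → HasSlabSpectralRepresentation G
→ IsSlabHausdorff dcf`, `G = criticalTwoPoint 3 = ⟨σ₀σ_x⟩⁺_{β_c(3)}` on `ℤ³`). If the kernel matrices
`M_A = (G(q - p))_{p,q∈A}` are positive definite Z-matrices with nonnegative inverse row sums, and
for every direction `i` and finitely supported real `v` on `ℤ²` the slab quadratic forms
`n ↦ ∑_{x,y} v x v y G(ins_i(n, x - y))` are Hausdorff moment sequences on `[0, 1]`, then the direct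
correlation function `a(y) = inf_A (-(M_A)⁻¹(0, y))` has the slab representation
`∑_y a(ins_i(n, y)) cos(k·y) = ∫ t^{n-1} dτ_{i,k}` (`n ≥ 1`) with finite positive measures
`τ_{i,k}` on `[0, 1]`.

**Proof** (files `…PickInversionAux.lean` – `…PickInversionAux17.lean`; there is no file 15).
1. *Infinite-volume equation* (tree, `EtaBoundsTransfer.limit_equation`): `A₀ G - a' ∗ G = δ₀` with
   `a' = 𝟙_{≠0} a ≥ 0` summable, `∑ a' ≤ A₀`; so `q = a'/A₀` is a symmetric sub-stochastic step law and
   `G' = A₀ G = δ₀ + q ∗ G'`, whence `G' = ∑_j q^{∗j}` (weak maximum principle, file 9) and, by the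
   weighted Parseval identity and Abel summation (files 10–11), the Green quadratic forms are
   Brillouin-zone integrals against `(1 - φ)⁻¹ ∈ L¹`, `φ = q̂`.
2. *Slabs* (files 12–14, 16): Fubini along the `i`-th coordinate expresses the slab forms through
   `h_n(k) = ∫ cos(nθ)(1 - φ(ins_i(θ,k)))⁻¹ dθ`; `φ < 1` off `(2πℤ)³` (positivity of `G` at the unit
   vectors), so `h_n` is continuous off the bad transverse momenta, and localisation with the
   binomial (de la Vallée-Poussin) test vectors plus Hausdorff weak compactness shows that
   `(h_n(k₀))_n` is a Hausdorff moment sequence at every good `k₀`.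
3. *Pick inversion* (files 1–8, 12 and this file): `1 - φ(ins_i(θ, k₀)) = (1 - α₀) - 2∑_{n≥1} αₙ cos(nθ)` with the slab
   modes `αₙ(k₀) = ∑_y q(ins_i(n,y)) cos(k₀·y)` (reflection symmetry of `G`, hence of `a`, file 17);
   the Poisson transform of `g = (1 - φ)⁻¹` has no zeros in the slit disc `ℂ ∖ [1, ∞)⁻¹…`, `-1/G` is
   a Pick function, and its Nevanlinna measure (tree: `nevanlinna_representation_holds`) lives on
   `[1, ∞)`; the substitution `t = 1/λ` gives `αₙ = ∫ t^{n-1} dτ`.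
4. *All momenta*: periodicity in `k`, density of good momenta and weak compactness (file 17).

Sources: Aizenman–Duminil-Copin 2021 §8 (spectral representation); Akhiezer, *The classical moment
problem*, Ch. 3 (Nevanlinna–Pick functions); Spitzer, *Principles of random walk*, §§ 7, 9 (Green
function of a sub-stochastic walk).
-/

noncomputable section

namespace Summit.CriticalPhenomena.Ising3DConformalLimit.Cruxes.DirectCorrelationStableTail.SelfEnergyPickInversion

open MeasureTheory Filter Topology Finset Real Literature.Probability.LatticeModels
open scoped BigOperators
open Summit.CriticalPhenomena.Ising3DConformalLimit.Theorems.EtaBoundsTransfer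
  (exists_A0 limit_equation summable_a a_nonneg a_neg continuous_phase continuous_fourier_q)

/-! ### Inputs on the critical two-point function -/

/-- `⟨σ₀σ_{e_m}⟩⁺_{β_c} > 0` (tree: `criticalTwoPoint_lower`). [folklore] -/
theorem criticalTwoPoint_single_pos (m : Fin 3) : 0 < criticalTwoPoint 3 (Pi.single m 1 : Site 3) := by
  obtain ⟨c, hc, hlow⟩ := criticalTwoPoint_lower (d := 3) (by norm_num)
  have hne : (Pi.single m 1 : Site 3) ≠ 0 := by
    intro h; have := congrFun h m; simp at this
  refine lt_of_lt_of_le ?_ (hlow _ hne)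
  have : 0 < ‖(Pi.single m (1 : ℤ) : Site 3)‖ := norm_pos_iff.2 hne
  positivity

/-- Reflection invariance of `⟨σ₀σ_x⟩⁺_{β_c}` (tree: `twoPointPlus_reflection_invariant_holds`).
[folklore] -/
theorem criticalTwoPoint_reflect (j : Fin 3) (x : Site 3) :
    criticalTwoPoint 3 (Function.update x j (-x j)) = criticalTwoPoint 3 x :=
  twoPointPlus_reflection_invariant_holds (criticalBeta_nonneg 3) j x

/-! ### Pick inversion of the slab modes at a good transverse momentum -/

/-- `θ ↦ ins_i(θ, k)` is continuous. [folklore] -/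
theorem continuous_insertNth_left (i : Fin 3) (k : Fin 2 → ℝ) :
    Continuous fun θ : ℝ => (Fin.insertNth i θ k : Fin 3 → ℝ) := by
  refine continuous_pi fun j => ?_
  refine Fin.succAboveCases i ?_ (fun j' => ?_) j
  · simp only [Fin.insertNth_apply_same]; exact continuous_id
  · simp only [Fin.insertNth_apply_succAbove]; exact continuous_const

/-- **Pick inversion of the slab modes at a good transverse momentum.** Let `q ≥ 0` be summable on
`ℤ³` with `∑ q ≤ 1`, symmetric under the reflection of the `i`-th coordinate, and let `k₀ ∈ ℝ²` be
such that `φ(ins_i(θ, k₀)) < 1` for all `θ` and the cosine moments of `1/(1 - φ(ins_i(·, k₀)))` are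
the moments of a finite positive measure on `[0, 1]`. Then the slab modes
`αₙ = ∑_y q(ins_i(n, y)) cos(k₀·y)` satisfy `αₙ = ∫ t^{n-1} dτ` (`n ≥ 1`) for a finite positive measure
`τ` on `[0, 1]`. [folklore] -/
theorem hausdorff_slabModes_of_good {q : Site 3 → ℝ} (hq0 : ∀ y, 0 ≤ q y) (hqs : Summable q)
    (i : Fin 3) (hqrefl : ∀ y : Site 3, q (Function.update y i (-y i)) = q y) (k₀ : Fin 2 → ℝ)
    (hgood : ∀ θ : ℝ, ∑' x : Site 3, q x * Real.cos (phase 3 (Fin.insertNth i θ k₀ : Fin 3 → ℝ) x) < 1)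
    {μ : Measure ℝ} [IsFiniteMeasure μ] (hμ : μ (Set.Icc (0 : ℝ) 1)ᶜ = 0)
    (hmom : ∀ n : ℕ, ∫ θ in (-π)..π, Real.cos (n * θ) /
      (1 - ∑' x : Site 3, q x * Real.cos (phase 3 (Fin.insertNth i θ k₀ : Fin 3 → ℝ) x)) = ∫ t, t ^ n ∂μ) :
    ∃ τ : Measure ℝ, IsFiniteMeasure τ ∧ τ (Set.Icc (0 : ℝ) 1)ᶜ = 0 ∧ ∀ n : ℕ, 1 ≤ n →
      ∑' y : Fin 2 → ℤ, q (Fin.insertNth i (n : ℤ) y) * Real.cos (phase 2 k₀ y) = ∫ t, t ^ (n - 1) ∂τ := by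
  have hπ := Real.pi_pos
  set φθ : ℝ → ℝ := fun θ => ∑' x : Site 3, q x * Real.cos (phase 3 (Fin.insertNth i θ k₀ : Fin 3 → ℝ) x) with hφθ
  have hφcont : Continuous φθ := (continuous_fourier_q hqs).comp (continuous_insertNth_left i k₀)
  set g : ℝ → ℝ := fun θ => (1 - φθ θ)⁻¹ with hg
  have hden : ∀ θ, 0 < 1 - φθ θ := fun θ => by have := hgood θ; simp only [hφθ]; linarith
  have hgcont : Continuous g := Continuous.inv₀ (by fun_prop) fun θ => (hden θ).ne'
  have hgpos : ∀ θ, 0 < g θ := fun θ => inv_pos.2 (hden θ)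
  -- periodicity
  have hφper : Function.Periodic φθ (2 * π) := by
    intro θ
    simp only [hφθ]
    refine tsum_congr fun x => ?_
    rw [phase_insertNth, phase_insertNth, show (θ + 2 * π) * (x i : ℝ) + phase 2 k₀ (fun j => x (i.succAbove j)) =
      θ * (x i : ℝ) + phase 2 k₀ (fun j => x (i.succAbove j)) + (x i : ℤ) * (2 * π) by ring,
      Real.cos_add_int_mul_two_pi]
  have hgper : Function.Periodic g (2 * π) := fun θ => by simp only [hg, hφper θ]
  -- evenness (reflection of the `i`-th coordinate)
  have hinv : Function.Involutive fun x : Site 3 => Function.update x i (-x i) := by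
    intro x; ext j
    by_cases hj : j = i
    · subst hj; simp
    · simp [Function.update_of_ne hj]
  set R : Site 3 ≃ Site 3 := hinv.toPerm _ with hR
  have hφeven : ∀ θ, φθ (-θ) = φθ θ := by
    intro θ
    simp only [hφθ]
    rw [← R.tsum_eq (fun x : Site 3 => q x * Real.cos (phase 3 (Fin.insertNth i θ k₀ : Fin 3 → ℝ) x))]
    refine tsum_congr fun x => ?_
    have hRx : R x = Function.update x i (-x i) := rfl
    rw [hRx, hqrefl, phase_insertNth, phase_insertNth]
    congr 2
    simp only [Function.update_self, Int.cast_neg]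
    have : (fun j => Function.update x i (-x i) (i.succAbove j)) = fun j => x (i.succAbove j) := by
      funext j; rw [Function.update_of_ne (Fin.succAbove_ne i j)]
    rw [this]; ring
  have hgeven : ∀ θ, g (-θ) = g θ := fun θ => by simp only [hg, hφeven θ]
  -- the moments of `g`
  have hmom' : ∀ n : ℕ, ∫ θ in (-π)..π, g θ * Real.cos (n * θ) = ∫ t, t ^ n ∂μ := by
    intro n
    rw [← hmom n]
    refine intervalIntegral.integral_congr fun θ _ => ?_
    simp only [hg]; rw [div_eq_mul_inv, mul_comm]
  -- the cosine series of `1/g = 1 - φ`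
  obtain ⟨hαsum, hser⟩ := hasSum_symbol_slab hq0 hqs i hqrefl k₀
  set α : ℕ → ℝ := fun n => ∑' y : Fin 2 → ℤ, q (Fin.insertNth i (n : ℤ) y) * Real.cos (phase 2 k₀ y) with hα
  set c : ℕ → ℝ := fun n => if n = 0 then 1 - α 0 else -2 * α n with hc
  have hcsum : Summable c := by
    refine Summable.of_norm_bounded ((hαsum.abs.mul_left 2).add (hasSum_ite_eq 0 |1 - α 0|).summable) fun n => ?_
    rw [Real.norm_eq_abs, hc]
    by_cases hn : n = 0
    · subst hn; simp
    · simp only [if_neg hn, abs_mul, abs_neg, abs_two, add_zero]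
      exact le_rfl
  have hsum : ∀ θ, HasSum (fun m : ℕ => c m * Real.cos (m * θ)) (g θ)⁻¹ := by
    intro θ
    have h := hser θ
    simp only [hg, inv_inv]
    refine h.congr_fun fun m => ?_
    by_cases hm : m = 0
    · subst hm; simp [hc, hα]
    · simp only [hc, hα, if_neg hm]
  obtain ⟨τ, hτfin, hτsupp, hτmom⟩ := hausdorff_of_inv_hasSum_cos hgcont hgper hgeven hgpos hμ hmom' hcsum hsum
  refine ⟨τ, hτfin, hτsupp, fun n hn => ?_⟩
  rw [← hτmom n hn]
  simp only [hc, if_neg (by omega : n ≠ 0), hα]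
  ring

/-! ### The stub -/

/-- **Registered stub `stub_pickInversion`** (signature EXACTLY as registered on stmt-CriticalPhenomena-4799; package form:
`IsSymmPotentialKernel (criticalTwoPoint 3) → Summable dcf → HasSlabSpectralRepresentation (criticalTwoPoint 3) → IsSlabHausdorff dcf`).
See the module docstring for the proof (infinite-volume equation, Green series and weighted
Parseval, slab localisation, Pick/Nevanlinna inversion, weak closure). [folklore] -/
theorem stub_pickInversion :
    (∀ A : Finset (Site 3), (Matrix.of fun (p q : ↥A) => criticalTwoPoint 3 (q.1 - p.1)).PosDef ∧ ∀ u v :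
      ↥A, (u ≠ v → (Matrix.of fun (p q : ↥A) => criticalTwoPoint 3 (q.1 - p.1))⁻¹ u v ≤ 0) ∧ 0 ≤ ∑ w,
      (Matrix.of fun (p q : ↥A) => criticalTwoPoint 3 (q.1 - p.1))⁻¹ u w) →
    Summable (fun x : Site 3 => (⨅ A : {A : Finset (Site 3) // (0 : Site 3) ∈ A ∧ x ∈ A}, -((Matrix.of fun
      (p q : ↥A.1) => criticalTwoPoint 3 (q.1 - p.1))⁻¹ ⟨0, A.2.1⟩ ⟨x, A.2.2⟩))) →
    (∀ (i : Fin 3) (s : Finset (Fin 2 → ℤ)) (v : (Fin 2 → ℤ) → ℝ), ∃ μ : MeasureTheory.Measure ℝ,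
      MeasureTheory.IsFiniteMeasure μ ∧ μ (Set.Icc (0 : ℝ) 1)ᶜ = 0 ∧ ∀ n : ℕ, ∑ x ∈ s, ∑ y ∈ s, v x * v y *
      criticalTwoPoint 3 (Fin.insertNth i (n : ℤ) (x - y) : Site 3) = ∫ t, t ^ n ∂μ) →
    (∀ (i : Fin 3) (k : Fin 2 → ℝ), ∃ τ : MeasureTheory.Measure ℝ, MeasureTheory.IsFiniteMeasure τ ∧ τ
      (Set.Icc (0 : ℝ) 1)ᶜ = 0 ∧ ∀ n : ℕ, 1 ≤ n → (∑' y : Fin 2 → ℤ, (⨅ A : {A : Finset (Site 3) // (0 :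
      Site 3) ∈ A ∧ (Fin.insertNth i (n : ℤ) (y) : Site 3) ∈ A}, -((Matrix.of fun (p q : ↥A.1) =>
      criticalTwoPoint 3 (q.1 - p.1))⁻¹ ⟨0, A.2.1⟩ ⟨(Fin.insertNth i (n : ℤ) (y) : Site 3), A.2.2⟩)) *
      Real.cos (∑ j, k j * (y j : ℝ))) = ∫ t, t ^ (n - 1) ∂τ) := by
  intro hH _hsum hSSR i k
  classical
  have hπ := Real.pi_pos
  -- the kernel matrices and the finite-volume data of `EtaBoundsTransfer`
  set M : (A : Finset (Site 3)) → Matrix ↥A ↥A ℝ :=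
    fun A => Matrix.of fun (p q : ↥A) => criticalTwoPoint 3 (q.1 - p.1) with hMdef
  have hM : ∀ A, M A = Matrix.of fun (p q : ↥A) => criticalTwoPoint 3 (q.1 - p.1) := fun A => rfl
  have hSP : ∀ A : Finset (Site 3), (M A).PosDef ∧
      ∀ u v : ↥A, (u ≠ v → (M A)⁻¹ u v ≤ 0) ∧ 0 ≤ ∑ w, (M A)⁻¹ u w := hH
  set kk : ℕ → ℝ := fun n => (M (box 3 n))⁻¹ ⟨0, zero_mem_box 3 n⟩ ⟨0, zero_mem_box 3 n⟩ with hkkdef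
  have hk : ∀ n, kk n = (M (box 3 n))⁻¹ ⟨0, zero_mem_box 3 n⟩ ⟨0, zero_mem_box 3 n⟩ := fun n => rfl
  set tt : ℕ → Site 3 → ℝ := fun n y =>
    if hy : y ∈ box 3 n then -(M (box 3 n))⁻¹ ⟨0, zero_mem_box 3 n⟩ ⟨y, hy⟩ else 0 with httdef
  have ht : ∀ n y (hy : y ∈ box 3 n), tt n y = -(M (box 3 n))⁻¹ ⟨0, zero_mem_box 3 n⟩ ⟨y, hy⟩ :=
    fun n y hy => by simp only [httdef, dif_pos hy]
  set a : Site 3 → ℝ := fun y => ⨅ A : {A : Finset (Site 3) // (0 : Site 3) ∈ A ∧ y ∈ A},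
    -((M A.1)⁻¹ ⟨0, A.2.1⟩ ⟨y, A.2.2⟩) with hadef
  have ha : ∀ y, a y = ⨅ A : {A : Finset (Site 3) // (0 : Site 3) ∈ A ∧ y ∈ A},
      -((M A.1)⁻¹ ⟨0, A.2.1⟩ ⟨y, A.2.2⟩) := fun y => rfl
  have hGto : Tendsto (criticalTwoPoint 3) cofinite (𝓝 0) := criticalTwoPoint_tendsto_zero_cofinite
  obtain ⟨A₀, hkA, hkle, hA0⟩ := exists_A0 hM hSP hGto hk
  have heq : ∀ z, A₀ * criticalTwoPoint 3 z - ∑' y, (if y = 0 then 0 else a y) * criticalTwoPoint 3 (z - y) =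
      if z = 0 then 1 else 0 := fun z => limit_equation hM hSP hGto hk ht ha hkA hkle z
  obtain ⟨hsa, hsale⟩ := summable_a hSP hk ht ha hkle
  have ha0 : ∀ y, y ≠ 0 → 0 ≤ a y := fun y hy => a_nonneg hSP ha hy
  have haev : ∀ y, y ≠ 0 → a (-y) = a y := fun y hy => a_neg hM hSP ht ha hy
  have harefl : ∀ y, y ≠ 0 → a (Function.update y i (-y i)) = a y :=
    fun y hy => a_reflect hM hSP ht ha i (criticalTwoPoint_reflect i) hy
  -- the normalised step law `q = a'/A₀` and Green function `G' = A₀ G`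
  set a' : Site 3 → ℝ := fun y => if y = 0 then 0 else a y with ha'def
  set q : Site 3 → ℝ := fun y => a' y / A₀ with hqdef
  set G' : Site 3 → ℝ := fun z => A₀ * criticalTwoPoint 3 z with hG'def
  have ha'0 : ∀ y, 0 ≤ a' y := fun y => by
    simp only [ha'def]; split_ifs with hy
    · exact le_rfl
    · exact ha0 y hy
  have hq0 : ∀ y, 0 ≤ q y := fun y => div_nonneg (ha'0 y) hA0.le
  have hqs : Summable q := hsa.div_const A₀
  have hq1 : ∑' y, q y ≤ 1 := by
    simp only [hqdef]; rw [tsum_div_const]; exact (div_le_one hA0).2 hsale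
  have hq00 : q 0 = 0 := by simp [hqdef, ha'def]
  have hqev : ∀ y, q (-y) = q y := by
    intro y
    by_cases hy : y = 0
    · subst hy; simp
    · simp only [hqdef, ha'def, neg_eq_zero, if_neg hy, haev y hy]
  have hR0 : ∀ y : Site 3, Function.update y i (-y i) = 0 ↔ y = 0 := by
    intro y
    constructor
    · intro h; ext j
      have hj := congrFun h j
      by_cases hji : j = i
      · subst hji; simpa using hj
      · rwa [Function.update_of_ne hji] at hj
    · rintro rfl; ext j; by_cases hji : j = i
      · subst hji; simp
      · simp [Function.update_of_ne hji]
  have hqrefl : ∀ y, q (Function.update y i (-y i)) = q y := by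
    intro y
    by_cases hy : y = 0
    · rw [hy, (hR0 0).2 rfl]
    · have hy' : Function.update y i (-y i) ≠ 0 := fun h => hy ((hR0 y).1 h)
      simp only [hqdef, ha'def, if_neg hy, if_neg hy', harefl y hy]
  have hG'0 : ∀ z, 0 ≤ G' z := fun z => mul_nonneg hA0.le (criticalTwoPoint_nonneg' z)
  have hG'C : ∀ z, G' z ≤ A₀ := fun z => by
    have := mul_le_mul_of_nonneg_left (criticalTwoPoint_le_one' (d := 3) z) hA0.le
    simpa [hG'def] using this
  have hG'to : Tendsto G' cofinite (𝓝 0) := by simpa [hG'def] using hGto.const_mul A₀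
  have hG'eq : ∀ z, G' z = (if z = 0 then 1 else 0) + ∑' y, q y * G' (z - y) := by
    intro z
    have h1 : ∑' y, q y * G' (z - y) = ∑' y, a' y * criticalTwoPoint 3 (z - y) :=
      tsum_congr fun y => by simp only [hqdef, hG'def]; field_simp
    rw [h1, ← heq z]; simp only [hG'def, ha'def]; ring
  -- convolution powers and the Green series
  set P : ℕ → Site 3 → ℝ := fun j => Nat.rec (fun z => if z = 0 then (1 : ℝ) else 0)
    (fun _ Pj z => ∑' y, q y * Pj (z - y)) j with hPdef
  have hP0 : ∀ z, P 0 z = if z = 0 then 1 else 0 := fun z => rfl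
  have hPs : ∀ j z, P (j + 1) z = ∑' y, q y * P j (z - y) := fun j z => rfl
  have hGreen : ∀ z, HasSum (fun j => P j z) (G' z) :=
    hasSum_convPow_of_green_equation hq0 hqs hq1 hq00 hP0 hPs hG'0 hG'C hG'to hG'eq
  have hGpos : ∀ m : Fin 3, 0 < G' (Pi.single m 1) := fun m => mul_pos hA0 (criticalTwoPoint_single_pos m)
  -- slab quadratic forms of `G'`
  have hHS : ∀ (s : Finset (Fin 2 → ℤ)) (v : (Fin 2 → ℤ) → ℝ), ∃ μ : Measure ℝ, IsFiniteMeasure μ ∧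
      μ (Set.Icc (0 : ℝ) 1)ᶜ = 0 ∧ ∀ n : ℕ,
        ∑ x ∈ s, ∑ y ∈ s, v x * v y * G' (Fin.insertNth i (n : ℤ) (x - y) : Site 3) = ∫ t, t ^ n ∂μ := by
    intro s v
    obtain ⟨μ, hμfin, hμ0, hμmom⟩ := hSSR i s v
    refine ⟨A₀.toNNReal • μ, inferInstance, by rw [Measure.smul_apply, hμ0, smul_zero], fun n => ?_⟩
    rw [integral_smul_nnreal_measure, ← hμmom n, NNReal.smul_def, smul_eq_mul, Real.coe_toNNReal _ hA0.le,
      Finset.mul_sum]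
    refine Finset.sum_congr rfl fun x _ => ?_
    rw [Finset.mul_sum]
    refine Finset.sum_congr rfl fun y _ => ?_
    simp only [hG'def]; ring
  -- good momenta
  have hgood : ∀ k₀ : Fin 2 → ℝ, (∀ j, |k₀ j| < π) → (∃ j, k₀ j ≠ 0) → ∃ τ : Measure ℝ, IsFiniteMeasure τ ∧
      τ (Set.Icc (0 : ℝ) 1)ᶜ = 0 ∧ ∀ n : ℕ, 1 ≤ n →
        ∑' y : Fin 2 → ℤ, a (Fin.insertNth i (n : ℤ) y) * Real.cos (phase 2 k₀ y) = ∫ t, t ^ (n - 1) ∂τ := by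
    intro k₀ hk₀ hne
    obtain ⟨hlt, μ₀, hμ₀fin, hμ₀0, hμ₀mom⟩ := slabMoments_of_openCube hq0 hqs hq1 hqev hP0 hPs hGreen hGpos i hHS hk₀ hne
    haveI := hμ₀fin
    obtain ⟨τ, hτfin, hτ0, hτmom⟩ := hausdorff_slabModes_of_good hq0 hqs i hqrefl k₀ hlt hμ₀0 hμ₀mom
    refine ⟨A₀.toNNReal • τ, inferInstance, by rw [Measure.smul_apply, hτ0, smul_zero], fun n hn => ?_⟩
    rw [integral_smul_nnreal_measure, ← hτmom n hn, NNReal.smul_def, smul_eq_mul, Real.coe_toNNReal _ hA0.le,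
      ← tsum_mul_left]
    refine tsum_congr fun y => ?_
    have hne0 := insertNth_ne_zero i (n := (n : ℤ)) (by exact_mod_cast (by omega : n ≠ 0)) y
    simp only [hqdef, ha'def, if_neg hne0]
    field_simp
  -- all momenta: periodic reduction and weak closure
  set F : ℕ → (Fin 2 → ℝ) → ℝ := fun n k => ∑' y : Fin 2 → ℤ, a (Fin.insertNth i (n : ℤ) y) * Real.cos (phase 2 k y)
    with hFdef
  have hrow : ∀ n : ℕ, 1 ≤ n → (Summable fun y : Fin 2 → ℤ => a (Fin.insertNth i (n : ℤ) y)) ∧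
      ∑' y : Fin 2 → ℤ, a (Fin.insertNth i (n : ℤ) y) ≤ A₀ := by
    intro n hn
    have hne0 : ∀ y, (Fin.insertNth i (n : ℤ) y : Site 3) ≠ 0 := fun y =>
      insertNth_ne_zero i (n := (n : ℤ)) (by exact_mod_cast (by omega : n ≠ 0)) y
    have heqa : (fun y : Fin 2 → ℤ => a (Fin.insertNth i (n : ℤ) y)) = fun y => a' (Fin.insertNth i (n : ℤ) y) := by
      funext y; simp only [ha'def, if_neg (hne0 y)]
    rw [heqa]
    refine ⟨hsa.comp_injective (insertNth_right_injective i n), ?_⟩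
    refine le_trans ?_ hsale
    exact Summable.tsum_le_tsum_of_inj _ (insertNth_right_injective i n) (fun c _ => ha'0 c) (fun y => le_rfl)
      (hsa.comp_injective (insertNth_right_injective i n)) hsa
  have hcontF : ∀ n, 1 ≤ n → Continuous (F n) := by
    intro n hn
    obtain ⟨hs, -⟩ := hrow n hn
    have hne0 : ∀ y, (Fin.insertNth i (n : ℤ) y : Site 3) ≠ 0 := fun y =>
      insertNth_ne_zero i (n := (n : ℤ)) (by exact_mod_cast (by omega : n ≠ 0)) y
    simp only [hFdef]
    refine continuous_tsum (fun y => ?_) hs fun y k => ?_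
    · have := continuous_phase (d := 2) y; fun_prop
    · rw [Real.norm_eq_abs, abs_mul, abs_of_nonneg (ha0 _ (hne0 y))]
      exact mul_le_of_le_one_right (ha0 _ (hne0 y)) (Real.abs_cos_le_one _)
  have hbdF : ∀ n k, 1 ≤ n → F n k ≤ A₀ := by
    intro n k hn
    obtain ⟨hs, hle⟩ := hrow n hn
    have hne0 : ∀ y, (Fin.insertNth i (n : ℤ) y : Site 3) ≠ 0 := fun y =>
      insertNth_ne_zero i (n := (n : ℤ)) (by exact_mod_cast (by omega : n ≠ 0)) y
    refine le_trans ?_ hle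
    have hs2 : Summable fun y : Fin 2 → ℤ => a (Fin.insertNth i (n : ℤ) y) * Real.cos (phase 2 k y) :=
      Summable.of_norm_bounded hs fun y => by
        rw [Real.norm_eq_abs, abs_mul, abs_of_nonneg (ha0 _ (hne0 y))]
        exact mul_le_of_le_one_right (ha0 _ (hne0 y)) (Real.abs_cos_le_one _)
    exact hs2.tsum_le_tsum (fun y => by
      have := mul_le_mul_of_nonneg_left (Real.cos_le_one (phase 2 k y)) (ha0 _ (hne0 y))
      simpa using this) hs
  obtain ⟨k', m, km, hkk', hlim, hkm⟩ := exists_reduce_approx k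
  have hclosure := slabHausdorff_of_limit (F := F) hcontF hbdF hlim fun N => hgood (km N) (hkm N).1 (hkm N).2
  obtain ⟨τ, hτfin, hτ0, hτmom⟩ := hclosure
  refine ⟨τ, hτfin, hτ0, fun n hn => ?_⟩
  have hper := tsum_mul_cos_periodic (fun y : Fin 2 → ℤ => a (Fin.insertNth i (n : ℤ) y)) k' m
  have hkfun : k = fun j => k' j + (m j : ℝ) * (2 * π) := funext hkk'
  have h1 : F n k = ∫ t, t ^ (n - 1) ∂τ := by rw [← hτmom n hn]; simp only [hFdef]; rw [hkfun, hper]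
  simpa only [hFdef, phase] using h1

end Summit.CriticalPhenomena.Ising3DConformalLimit.Cruxes.DirectCorrelationStableTail.SelfEnergyPickInversion

end
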